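import Summits.CriticalPhenomena.PercolationContinuityZ3.Theorems.PercNearOneGluingNoHeavyLowerTailCSHSharpWitness
import HarnessLib

/-!
# The conditioned slack hierarchy with EMPTY avoided set is attained — part 2: the margins of the all-open star `f_S`
# (PAPER-2 track (ii), §7 `s:gluing-constants`, Prop. `prop:csh-sharp` (a)(b)(c))

builds on p205010 (kernel theorem, internal audit signed; external expert review pending)

Helper file for the cruxes `NoHeavyLowerTail` (stmt-CriticalPhenomena-4575) / `AdditiveGluing` (stmt-4576); continuation of
`…Theorems.PercNearOneGluingNoHeavyLowerTailCSHSharpWitness` (events `hits`, functional `f_S = CSH.SharpWitness.allOpenTo S v`,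
star weight `W = CSH.SharpWitness.starWeight w S v`, independence and the decoy induction `slForm_decoyList_of_hits`), whose
module docstring states the whole development.  Notation as there: `S = {x} ∪ D ∌ v`, `{u ~ A} = hits u A`, `c_j = CSH.avoidConst`,
`p = CSH.obsConst`, `B_j = W·μ{d_j ↮ {x} ∪ D_<j}`.  No named facts, no sorries; standard axioms.  Proved here:

* (a) `slForm_decoyList_covD_allOpenTo` — `sl_{D₁}[covD(f_S)](u) = W·(μ{u ~ S ∪ {v}} − μ{u ~ {x} ∪ D₁})` at every level
  (all pair weights in `[0,1]`, any finite graph), with the values at a decoy (`…_decoy`: the coefficient `B`), at `v` (`…_obs`)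
  and at `o` (`…_top`);
* (b) `cshMargin_allOpenTo_eq_zero` (+ primed finset form, `nonpos_of_le_cshMargin_forall`) — `cshMargin w x ∅ D o v f_S = 0`:
  CSH(∅; x; D; o, v)[f_S] holds with EQUALITY, so memo Theorem 1 (`CSH.cshHolds`) admits no positive additive slack at `Y = ∅`;
* (c) exact affine one-parameter perturbation formulas `cshMarg_allOpenTo_obsConst'` (`p ↦ p'`: `(p − p')·W·μ{v ↮ S}`),
  `cshMarg_allOpenTo_perturb_o` (`−(c'(o) − c_j(o))·B_j`), `cshMarg_allOpenTo_perturb_v` (`p·(c'(v) − c_j(v))·B_j`), and for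
  non-degenerate weights `0 < w < 1` the strict signs `cshMarg_allOpenTo_neg_of_obsConst_lt / _neg_of_lt_at_o / _neg_of_lt_at_v`,
  packaged as `exists_cshMarg_neg_of_obsConst_lt / _of_lt_at_o / _of_lt_at_v`: raising `p`, raising one `c_j(o)` or lowering one
  `c_j(v)` makes the margin of `f_S` negative — each of the `2k+1` principal constants of the level-`k` hierarchy is best possible
  in its strengthening direction on every finite weighted graph, witnessed by the single functional `f_S`.

Written by the paper cell (prim-paper-s3, gen 66) from memo `run/shared/lean/prim/consts/FROM-prim-paper-s3-g65-CSH-SHARPNESS-ADDENDUM.md`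
(finding F5; numbers re-derived independently by CONSTS-REF `consts/csh_ref2.py`); split into two files (≤ 400 lines) and landed
verbatim by a prover seat.
[cite: VandenbergHaggstromKahn2005, Thm. 1.3 (p. 6)] [cite: KozmaNitzan2024, Conj. 4 (p. 32)]
-/

noncomputable section

namespace Summit.CriticalPhenomena.PercolationContinuityZ3.Theorems

open MeasureTheory Set Literature.Probability.LatticeModels Literature.Probability.Percolation
open scoped Classical

namespace CSH

namespace SharpWitness

variable {V : Type*}

/-- **(a) at every level.**  For `x ∈ S`, `v ∉ S` and any list `D₁` of elements of `S` (a prefix of the decoys),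
`sl_{D₁}[covD w x ∅ f_S](u) = W · ( μ{u ~ S ∪ {v}} − μ{u ~ {x} ∪ D₁} )`.
(paper-2 track (ii), Prop. `prop:csh-sharp` (a); memo F5 identity (*)) -/
theorem slForm_decoyList_covD_allOpenTo [Fintype V] (w : Sym2 V → unitInterval) {S : Finset V} {x v : V}
    (hx : x ∈ S) (hv : v ∉ S) (D₁ : List V) (hD₁ : ∀ d ∈ D₁, d ∈ S) (u : V) :
    slForm (decoyList w {x} D₁) (covD w x ∅ (allOpenTo S v)) u =
      starWeight w S v * ((prodBernoulli w).real (hits u (insert v (↑S : Set V))) -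
        (prodBernoulli w).real (hits u ({x} ∪ {d | d ∈ D₁}))) :=
  slForm_decoyList_of_hits w (insert v (↑S : Set V)) (starWeight w S v) D₁ {x} _
    (fun d hd => mem_insert_of_mem _ (Finset.mem_coe.2 (hD₁ d hd))) (covD_empty_allOpenTo w hx hv) u

/-- **The level coefficient `B`**: at a vertex `d ∈ S` (the next decoy), `sl_{D₁}[covD w x ∅ f_S](d) = W · μ{d ↮ {x} ∪ D₁}`.
(paper-2 track (ii), Prop. `prop:csh-sharp` (b); memo F5, `B_j = W·P(E_j)`) -/
theorem slForm_decoyList_covD_allOpenTo_decoy [Fintype V] (w : Sym2 V → unitInterval) {S : Finset V} {x v : V}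
    (hx : x ∈ S) (hv : v ∉ S) (D₁ : List V) (hD₁ : ∀ d ∈ D₁, d ∈ S) {d : V} (hd : d ∈ S) :
    slForm (decoyList w {x} D₁) (covD w x ∅ (allOpenTo S v)) d =
      starWeight w S v *
        (prodBernoulli w).real {ω : BondConfig V | ∀ a ∈ ({x} ∪ {d | d ∈ D₁} : Set V), ¬ (openGraph ω).Reachable d a} := by
  rw [slForm_decoyList_covD_allOpenTo w hx hv D₁ hD₁,
    hits_eq_univ_of_mem (mem_insert_of_mem _ (Finset.mem_coe.2 hd)), probReal_univ, real_avoid_eq_one_sub]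

/-- The value at `v`: `sl_{D₁}[covD w x ∅ f_S](v) = W · μ{v ↮ {x} ∪ D₁}`. (paper-2 track (ii), Prop. `prop:csh-sharp` (b)) -/
theorem slForm_decoyList_covD_allOpenTo_obs [Fintype V] (w : Sym2 V → unitInterval) {S : Finset V} {x v : V}
    (hx : x ∈ S) (hv : v ∉ S) (D₁ : List V) (hD₁ : ∀ d ∈ D₁, d ∈ S) :
    slForm (decoyList w {x} D₁) (covD w x ∅ (allOpenTo S v)) v =
      starWeight w S v *
        (prodBernoulli w).real {ω : BondConfig V | ∀ a ∈ ({x} ∪ {d | d ∈ D₁} : Set V), ¬ (openGraph ω).Reachable v a} := by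
  rw [slForm_decoyList_covD_allOpenTo w hx hv D₁ hD₁, hits_eq_univ_of_mem (mem_insert _ _), probReal_univ,
    real_avoid_eq_one_sub]

/-- The value at `o` at the top level (`{x} ∪ D = S`): `sl_D[covD w x ∅ f_S](o) = W · μ{v ↮ S, o ↔ v}`.
(paper-2 track (ii), Prop. `prop:csh-sharp` (b)) -/
theorem slForm_decoyList_covD_allOpenTo_top [Fintype V] (w : Sym2 V → unitInterval) {S : Finset V} {x v : V}
    (hv : v ∉ S) (D : List V) (hS : (↑S : Set V) = {x} ∪ {d | d ∈ D}) (o : V) :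
    slForm (decoyList w {x} D) (covD w x ∅ (allOpenTo S v)) o =
      starWeight w S v *
        (prodBernoulli w).real ({ω : BondConfig V | ∀ a ∈ (↑S : Set V), ¬ (openGraph ω).Reachable v a} ∩ openConn o v) := by
  have hx : x ∈ S := by rw [← Finset.mem_coe, hS]; exact Or.inl rfl
  have hD : ∀ d ∈ D, d ∈ S := fun d hd => by rw [← Finset.mem_coe, hS]; exact Or.inr hd
  rw [slForm_decoyList_covD_allOpenTo w hx hv D hD, ← hS, real_hits_insert,
    show (openConn v o : Set (BondConfig V)) = openConn o v by
      ext ω; exact ⟨fun h => SimpleGraph.Reachable.symm h, fun h => SimpleGraph.Reachable.symm h⟩]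
  ring

/-! ### (b) The margin of `f_S` vanishes -/

/-- **(b) CSH(∅; x; D; o, v)[f_S] holds with EQUALITY**: `cshMargin w x ∅ D o v f_S = 0` whenever `S = {x} ∪ D ∌ v`
(every finite graph, all pair weights in `[0,1]`, decoys not necessarily distinct).
(paper-2 track (ii), Prop. `prop:csh-sharp` (b); memo F5 / F2) -/
theorem cshMargin_allOpenTo_eq_zero [Fintype V] (w : Sym2 V → unitInterval) (x v o : V) (D : List V) (S : Finset V)
    (hS : (↑S : Set V) = {x} ∪ {d | d ∈ D}) (hv : v ∉ S) : cshMargin w x ∅ D o v (allOpenTo S v) = 0 := by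
  have hx : x ∈ S := by rw [← Finset.mem_coe, hS]; exact Or.inl rfl
  have hD : ∀ d ∈ D, d ∈ S := fun d hd => by rw [← Finset.mem_coe, hS]; exact Or.inr hd
  have h1 : (insert x (∅ : Set V)) = ({x} : Set V) := by ext z; simp
  simp only [cshMargin, cshMarg, h1]
  rw [slForm_decoyList_covD_allOpenTo_top w hv D hS o, slForm_decoyList_covD_allOpenTo_obs w hx hv D hD,
    show ({x} ∪ {d | d ∈ D} : Set V) = (↑S : Set V) from hS.symm, mul_left_comm (obsConst w o v _),
    obsConst_mul_real]
  ring

/-- The same with the canonical finset `S = insert x D.toFinset`. (paper-2 track (ii), Prop. `prop:csh-sharp` (b)) -/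
theorem cshMargin_allOpenTo_eq_zero' [Fintype V] (w : Sym2 V → unitInterval) (x v o : V) (D : List V) (hvx : v ≠ x)
    (hvD : v ∉ D) : cshMargin w x ∅ D o v (allOpenTo (insert x D.toFinset) v) = 0 := by
  refine cshMargin_allOpenTo_eq_zero w x v o D _ ?_ ?_
  · ext z; simp
  · simp [hvx, hvD]

/-- In particular memo Theorem 1 admits no positive additive slack at `Y = ∅`: if `ε ≤ cshMargin w x ∅ D o v f` for every
monotone `f`, then `ε ≤ 0`. (paper-2 track (ii), Prop. `prop:csh-sharp` (b)) -/
theorem nonpos_of_le_cshMargin_forall [Fintype V] (w : Sym2 V → unitInterval) (x v o : V) (D : List V) (hvx : v ≠ x)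
    (hvD : v ∉ D) {ε : ℝ} (h : ∀ f : Set (Sym2 V) → ℝ, Monotone f → ε ≤ cshMargin w x ∅ D o v f) : ε ≤ 0 :=
  (h _ (allOpenTo_monotone _ v)).trans_eq (cshMargin_allOpenTo_eq_zero' w x v o D hvx hvD)

/-! ### (c) One parameter at a time: exact formulas for the perturbed margins -/

/-- **Observer constant.** With the decoy constants kept and `p` replaced by any `p'`, the margin of `f_S` is
`(p − p')·W·μ{v ↮ S}` (affine in `p'`, zero at `p' = p`). (paper-2 track (ii), Prop. `prop:csh-sharp` (c)) -/
theorem cshMarg_allOpenTo_obsConst' [Fintype V] (w : Sym2 V → unitInterval) (x v o : V) (D : List V) (S : Finset V)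
    (hS : (↑S : Set V) = {x} ∪ {d | d ∈ D}) (hv : v ∉ S) (p' : ℝ) :
    cshMarg (decoyList w {x} D) p' o v (covD w x ∅ (allOpenTo S v)) =
      (obsConst w o v ↑S - p') * (starWeight w S v *
        (prodBernoulli w).real {ω : BondConfig V | ∀ a ∈ (↑S : Set V), ¬ (openGraph ω).Reachable v a}) := by
  have hx : x ∈ S := by rw [← Finset.mem_coe, hS]; exact Or.inl rfl
  have hD : ∀ d ∈ D, d ∈ S := fun d hd => by rw [← Finset.mem_coe, hS]; exact Or.inr hd
  simp only [cshMarg]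
  rw [slForm_decoyList_covD_allOpenTo_top w hv D hS o, slForm_decoyList_covD_allOpenTo_obs w hx hv D hD,
    show ({x} ∪ {d | d ∈ D} : Set V) = (↑S : Set V) from hS.symm, sub_mul, mul_left_comm (obsConst w o v _),
    obsConst_mul_real]

/-- `slForm` of a concatenation is the composite. [folklore] -/
theorem slForm_append (L₁ L₂ : List (V × (V → ℝ))) (g : V → ℝ) : slForm (L₁ ++ L₂) g = slForm L₂ (slForm L₁ g) := by
  simp only [slForm, List.foldl_append]

/-- **Changing one decoy constant.** Replacing the constant `c` of one decoy `d` by `c'` changes the margin by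
`−sl_{L₁}[g](d) · Marg_{L₂}[c' − c]` (linearity of the later levels). [folklore] -/
theorem cshMarg_replace (L₁ L₂ : List (V × (V → ℝ))) (d : V) (c c' : V → ℝ) (p : ℝ) (o v : V) (g : V → ℝ) :
    cshMarg (L₁ ++ (d, c') :: L₂) p o v g =
      cshMarg (L₁ ++ (d, c) :: L₂) p o v g - slForm L₁ g d * cshMarg L₂ p o v (c' - c) := by
  have hstep : slStep (d, c') (slForm L₁ g) = slStep (d, c) (slForm L₁ g) + (-(slForm L₁ g d)) • (c' - c) := by
    funext u; simp only [slStep, Pi.add_apply, Pi.smul_apply, Pi.sub_apply, smul_eq_mul]; ring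
  simp only [cshMarg, slForm_append, slForm_cons_eq, hstep, slForm_add, slForm_smul, Pi.add_apply, Pi.smul_apply,
    smul_eq_mul]
  ring

/-- A function vanishing at every decoy passes through the level forms unchanged. [folklore] -/
theorem slForm_eq_self_of_forall_zero :
    ∀ (L : List (V × (V → ℝ))) (δ : V → ℝ), (∀ dc ∈ L, δ dc.1 = 0) → slForm L δ = δ := by
  intro L
  induction L with
  | nil => intro δ _; rfl
  | cons dc L ih =>
    intro δ hδ
    have h0 : δ dc.1 = 0 := hδ dc (by simp)
    have hstep : slStep dc δ = δ := by
      funext u; simp only [slStep, h0, mul_zero, sub_zero]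
    rw [slForm_cons_eq, hstep]
    exact ih δ fun dc' hdc' => hδ dc' (by simp [hdc'])

/-- The decoys of `decoyList w A D` are the elements of `D`. [folklore] -/
theorem mem_decoyList_fst (w : Sym2 V → unitInterval) :
    ∀ (D : List V) (A : Set V) (dc : V × (V → ℝ)), dc ∈ decoyList w A D → dc.1 ∈ D := by
  intro D
  induction D with
  | nil => intro A dc h; simp [decoyList] at h
  | cons d ds ih =>
    intro A dc h
    simp only [decoyList, List.mem_cons] at h
    rcases h with rfl | h
    · simp
    · exact List.mem_cons_of_mem _ (ih _ _ h)

/-- **Decoy constant changed at `o` only.** Datum `D = D₁ ++ d :: D₂` with `Y = ∅`; replace the constant `c = c_d` of the decoy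
`d` by any `c'` agreeing with `c` off `o` (so `c(v)` and the cross constants `c(d_i)` are kept), where `o ≠ v` is not a later decoy.
Then the margin of `f_S` equals `−(c'(o) − c(o)) · B`, `B = W·μ{d ↮ {x} ∪ D₁}`.
(paper-2 track (ii), Prop. `prop:csh-sharp` (c)) -/
theorem cshMarg_allOpenTo_perturb_o [Fintype V] (w : Sym2 V → unitInterval) (x v o : V) (D₁ D₂ : List V) (d : V)
    (S : Finset V) (hS : (↑S : Set V) = {x} ∪ {d' | d' ∈ D₁ ++ d :: D₂}) (hv : v ∉ S) (hov : o ≠ v) (ho₂ : o ∉ D₂)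
    (c' : V → ℝ) (hc' : ∀ u, u ≠ o → c' u = avoidConst w d ({x} ∪ {d' | d' ∈ D₁}) u) :
    cshMarg (decoyList w {x} D₁ ++ (d, c') :: decoyList w (insert d ({x} ∪ {d' | d' ∈ D₁})) D₂)
        (obsConst w o v ↑S) o v (covD w x ∅ (allOpenTo S v)) =
      -(c' o - avoidConst w d ({x} ∪ {d' | d' ∈ D₁}) o) * (starWeight w S v *
        (prodBernoulli w).real {ω : BondConfig V | ∀ a ∈ ({x} ∪ {d' | d' ∈ D₁} : Set V), ¬ (openGraph ω).Reachable d a}) := by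
  have hx : x ∈ S := by rw [← Finset.mem_coe, hS]; exact Or.inl rfl
  have hD : ∀ d' ∈ D₁ ++ d :: D₂, d' ∈ S := fun d' hd' => by rw [← Finset.mem_coe, hS]; exact Or.inr hd'
  have hD₁ : ∀ d' ∈ D₁, d' ∈ S := fun d' hd' => hD d' (List.mem_append_left _ hd')
  have hdS : d ∈ S := hD d (by simp)
  -- the unperturbed list is `decoyList w {x} (D₁ ++ d :: D₂)`, whose margin at the true `p` vanishes
  have hL : decoyList w {x} (D₁ ++ d :: D₂) =
      decoyList w {x} D₁ ++ (d, avoidConst w d ({x} ∪ {d' | d' ∈ D₁})) ::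
        decoyList w (insert d ({x} ∪ {d' | d' ∈ D₁})) D₂ := by
    rw [decoyList_append, decoyList]
  have h0 : cshMarg (decoyList w {x} (D₁ ++ d :: D₂)) (obsConst w o v ↑S) o v (covD w x ∅ (allOpenTo S v)) = 0 := by
    have := cshMargin_allOpenTo_eq_zero w x v o (D₁ ++ d :: D₂) S hS hv
    have h1 : (insert x (∅ : Set V)) = ({x} : Set V) := by ext z; simp
    simp only [cshMargin, h1] at this
    rwa [show ({x} ∪ {d' | d' ∈ D₁ ++ d :: D₂} : Set V) = (↑S : Set V) from hS.symm] at this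
  rw [hL] at h0
  -- the perturbation `c' − c` is supported at `o`, which is neither `v` nor a later decoy
  have hδ : slForm (decoyList w (insert d ({x} ∪ {d' | d' ∈ D₁})) D₂)
      (c' - avoidConst w d ({x} ∪ {d' | d' ∈ D₁})) = c' - avoidConst w d ({x} ∪ {d' | d' ∈ D₁}) := by
    refine slForm_eq_self_of_forall_zero _ _ fun dc hdc => ?_
    have hmem := mem_decoyList_fst w D₂ _ dc hdc
    have hne : dc.1 ≠ o := fun h => ho₂ (h ▸ hmem)
    simp only [Pi.sub_apply, hc' dc.1 hne, sub_self]
  rw [cshMarg_replace _ _ d (avoidConst w d ({x} ∪ {d' | d' ∈ D₁})) c', h0, zero_sub, cshMarg, hδ,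
    slForm_decoyList_covD_allOpenTo_decoy w hx hv D₁ hD₁ hdS]
  simp only [Pi.sub_apply, hc' v hov.symm, sub_self, mul_zero, sub_zero]
  ring

/-- **Decoy constant changed at `v` only.** As above with `c'` agreeing with `c` off `v` (`o ≠ v`, `v` not a later decoy):
the margin of `f_S` equals `p · (c'(v) − c(v)) · B`. (paper-2 track (ii), Prop. `prop:csh-sharp` (c)) -/
theorem cshMarg_allOpenTo_perturb_v [Fintype V] (w : Sym2 V → unitInterval) (x v o : V) (D₁ D₂ : List V) (d : V)
    (S : Finset V) (hS : (↑S : Set V) = {x} ∪ {d' | d' ∈ D₁ ++ d :: D₂}) (hv : v ∉ S) (hov : o ≠ v)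
    (c' : V → ℝ) (hc' : ∀ u, u ≠ v → c' u = avoidConst w d ({x} ∪ {d' | d' ∈ D₁}) u) :
    cshMarg (decoyList w {x} D₁ ++ (d, c') :: decoyList w (insert d ({x} ∪ {d' | d' ∈ D₁})) D₂)
        (obsConst w o v ↑S) o v (covD w x ∅ (allOpenTo S v)) =
      obsConst w o v ↑S * (c' v - avoidConst w d ({x} ∪ {d' | d' ∈ D₁}) v) * (starWeight w S v *
        (prodBernoulli w).real {ω : BondConfig V | ∀ a ∈ ({x} ∪ {d' | d' ∈ D₁} : Set V), ¬ (openGraph ω).Reachable d a}) := by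
  have hx : x ∈ S := by rw [← Finset.mem_coe, hS]; exact Or.inl rfl
  have hD : ∀ d' ∈ D₁ ++ d :: D₂, d' ∈ S := fun d' hd' => by rw [← Finset.mem_coe, hS]; exact Or.inr hd'
  have hD₁ : ∀ d' ∈ D₁, d' ∈ S := fun d' hd' => hD d' (List.mem_append_left _ hd')
  have hdS : d ∈ S := hD d (by simp)
  have hv₂ : v ∉ D₂ := fun h => hv (hD v (by simp [h]))
  have hL : decoyList w {x} (D₁ ++ d :: D₂) =
      decoyList w {x} D₁ ++ (d, avoidConst w d ({x} ∪ {d' | d' ∈ D₁})) ::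
        decoyList w (insert d ({x} ∪ {d' | d' ∈ D₁})) D₂ := by
    rw [decoyList_append, decoyList]
  have h0 : cshMarg (decoyList w {x} (D₁ ++ d :: D₂)) (obsConst w o v ↑S) o v (covD w x ∅ (allOpenTo S v)) = 0 := by
    have := cshMargin_allOpenTo_eq_zero w x v o (D₁ ++ d :: D₂) S hS hv
    have h1 : (insert x (∅ : Set V)) = ({x} : Set V) := by ext z; simp
    simp only [cshMargin, h1] at this
    rwa [show ({x} ∪ {d' | d' ∈ D₁ ++ d :: D₂} : Set V) = (↑S : Set V) from hS.symm] at this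
  rw [hL] at h0
  have hδ : slForm (decoyList w (insert d ({x} ∪ {d' | d' ∈ D₁})) D₂)
      (c' - avoidConst w d ({x} ∪ {d' | d' ∈ D₁})) = c' - avoidConst w d ({x} ∪ {d' | d' ∈ D₁}) := by
    refine slForm_eq_self_of_forall_zero _ _ fun dc hdc => ?_
    have hmem := mem_decoyList_fst w D₂ _ dc hdc
    have hne : dc.1 ≠ v := fun h => hv₂ (h ▸ hmem)
    simp only [Pi.sub_apply, hc' dc.1 hne, sub_self]
  rw [cshMarg_replace _ _ d (avoidConst w d ({x} ∪ {d' | d' ∈ D₁})) c', h0, zero_sub, cshMarg, hδ,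
    slForm_decoyList_covD_allOpenTo_decoy w hx hv D₁ hD₁ hdS]
  simp only [Pi.sub_apply, hc' o hov, sub_self]
  ring

/-! ### Strict signs for non-degenerate weights -/

/-- `W > 0` for positive weights. [folklore] -/
theorem starWeight_pos (w : Sym2 V → unitInterval) (hw : ∀ e, 0 < w e ∧ w e < 1) (S : Finset V) (v : V) :
    0 < starWeight w S v :=
  Finset.prod_pos fun s _ => unitInterval.coe_pos.2 (hw s(s, v)).1

/-- `μ{u ↮ A} > 0` for `u ∉ A` and weights `< 1` (the empty configuration avoids everything). [folklore] -/
theorem real_avoid_pos [Fintype V] (w : Sym2 V → unitInterval) (hw : ∀ e, 0 < w e ∧ w e < 1) {u : V} {A : Set V}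
    (hu : u ∉ A) : 0 < (prodBernoulli w).real {ω : BondConfig V | ∀ a ∈ A, ¬ (openGraph ω).Reachable u a} := by
  refine prodBernoulli_real_pos_of_nonempty hw ⟨∅, fun a ha hr => ?_⟩
  have hbot : openGraph (∅ : BondConfig V) = ⊥ := by unfold openGraph; exact SimpleGraph.fromEdgeSet_empty
  rw [hbot, SimpleGraph.reachable_bot] at hr
  exact hu (hr ▸ ha)

/-- `μ{v ↮ A, o ↔ v} > 0` for `o, v ∉ A`, `o ≠ v` (the configuration with the single open pair `s(o, v)`). [folklore] -/
theorem real_avoid_inter_openConn_pos [Fintype V] (w : Sym2 V → unitInterval) (hw : ∀ e, 0 < w e ∧ w e < 1) {o v : V}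
    {A : Set V} (ho : o ∉ A) (hv : v ∉ A) (hov : o ≠ v) :
    0 < (prodBernoulli w).real ({ω : BondConfig V | ∀ a ∈ A, ¬ (openGraph ω).Reachable v a} ∩ openConn o v) := by
  refine prodBernoulli_real_pos_of_nonempty hw ⟨{s(o, v)}, fun a ha hr => ?_, ?_⟩
  · -- in the one-edge configuration the cluster of `v` is `{o, v}`
    have key : ∀ z, (openGraph ({s(o, v)} : BondConfig V)).Reachable v z → z = v ∨ z = o := by
      intro z hz
      rw [SimpleGraph.reachable_iff_reflTransGen] at hz
      induction hz with
      | refl => exact Or.inl rfl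
      | tail _ hbc ih =>
        rename_i b c
        rw [openGraph_adj, mem_singleton_iff] at hbc
        rcases Sym2.eq_iff.1 hbc.1 with ⟨rfl, rfl⟩ | ⟨rfl, rfl⟩
        · exact Or.inl rfl
        · exact Or.inr rfl
    rcases key a hr with rfl | rfl
    · exact hv ha
    · exact ho ha
  · exact ((openGraph_adj _ o v).2 ⟨mem_singleton _, hov⟩).reachable

/-- `p = obsConst > 0` for non-degenerate weights and `o, v ∉ A`, `o ≠ v`. [folklore] -/
theorem obsConst_pos [Fintype V] (w : Sym2 V → unitInterval) (hw : ∀ e, 0 < w e ∧ w e < 1) {o v : V} {A : Set V}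
    (ho : o ∉ A) (hv : v ∉ A) (hov : o ≠ v) : 0 < obsConst w o v A :=
  div_pos (real_avoid_inter_openConn_pos w hw ho hv hov) (real_avoid_pos w hw hv)

/-- **Raising the observer constant breaks CSH(∅)[f_S].** Non-degenerate weights, `S = {x} ∪ D ∌ v`: for every `p' > p`
the margin of `f_S` with `p'` in place of `p` is negative. (paper-2 track (ii), Prop. `prop:csh-sharp` (c)) -/
theorem cshMarg_allOpenTo_neg_of_obsConst_lt [Fintype V] (w : Sym2 V → unitInterval) (hw : ∀ e, 0 < w e ∧ w e < 1)
    (x v o : V) (D : List V) (S : Finset V) (hS : (↑S : Set V) = {x} ∪ {d | d ∈ D}) (hv : v ∉ S) {p' : ℝ}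
    (hp' : obsConst w o v ↑S < p') : cshMarg (decoyList w {x} D) p' o v (covD w x ∅ (allOpenTo S v)) < 0 := by
  rw [cshMarg_allOpenTo_obsConst' w x v o D S hS hv p']
  exact mul_neg_of_neg_of_pos (sub_neg.2 hp')
    (mul_pos (starWeight_pos w hw S v) (real_avoid_pos w hw (fun h => hv (Finset.mem_coe.1 h))))

/-- **Raising one decoy constant at `o` breaks CSH(∅)[f_S].** Non-degenerate weights, datum `D = D₁ ++ d :: D₂`,
`S = {x} ∪ D ∌ v`, `o ≠ v` not a later decoy, `d ∉ {x} ∪ D₁` (the decoy is fresh): if `c'` agrees with `c_d` off `o` and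
`c'(o) > c_d(o)`, the margin of `f_S` is negative. (paper-2 track (ii), Prop. `prop:csh-sharp` (c)) -/
theorem cshMarg_allOpenTo_neg_of_lt_at_o [Fintype V] (w : Sym2 V → unitInterval) (hw : ∀ e, 0 < w e ∧ w e < 1)
    (x v o : V) (D₁ D₂ : List V) (d : V) (S : Finset V) (hS : (↑S : Set V) = {x} ∪ {d' | d' ∈ D₁ ++ d :: D₂})
    (hv : v ∉ S) (hov : o ≠ v) (ho₂ : o ∉ D₂) (hd : d ∉ ({x} ∪ {d' | d' ∈ D₁} : Set V)) (c' : V → ℝ)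
    (hc' : ∀ u, u ≠ o → c' u = avoidConst w d ({x} ∪ {d' | d' ∈ D₁}) u)
    (hlt : avoidConst w d ({x} ∪ {d' | d' ∈ D₁}) o < c' o) :
    cshMarg (decoyList w {x} D₁ ++ (d, c') :: decoyList w (insert d ({x} ∪ {d' | d' ∈ D₁})) D₂)
      (obsConst w o v ↑S) o v (covD w x ∅ (allOpenTo S v)) < 0 := by
  rw [cshMarg_allOpenTo_perturb_o w x v o D₁ D₂ d S hS hv hov ho₂ c' hc']
  exact mul_neg_of_neg_of_pos (neg_neg_of_pos (sub_pos.2 hlt))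
    (mul_pos (starWeight_pos w hw S v) (real_avoid_pos w hw hd))

/-- **Lowering one decoy constant at `v` breaks CSH(∅)[f_S].** As above with `c'` agreeing with `c_d` off `v`,
`c'(v) < c_d(v)`, and `o ∉ S` (so that `p > 0`). (paper-2 track (ii), Prop. `prop:csh-sharp` (c)) -/
theorem cshMarg_allOpenTo_neg_of_lt_at_v [Fintype V] (w : Sym2 V → unitInterval) (hw : ∀ e, 0 < w e ∧ w e < 1)
    (x v o : V) (D₁ D₂ : List V) (d : V) (S : Finset V) (hS : (↑S : Set V) = {x} ∪ {d' | d' ∈ D₁ ++ d :: D₂})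
    (hv : v ∉ S) (ho : o ∉ S) (hov : o ≠ v) (hd : d ∉ ({x} ∪ {d' | d' ∈ D₁} : Set V)) (c' : V → ℝ)
    (hc' : ∀ u, u ≠ v → c' u = avoidConst w d ({x} ∪ {d' | d' ∈ D₁}) u)
    (hlt : c' v < avoidConst w d ({x} ∪ {d' | d' ∈ D₁}) v) :
    cshMarg (decoyList w {x} D₁ ++ (d, c') :: decoyList w (insert d ({x} ∪ {d' | d' ∈ D₁})) D₂)
      (obsConst w o v ↑S) o v (covD w x ∅ (allOpenTo S v)) < 0 := by
  rw [cshMarg_allOpenTo_perturb_v w x v o D₁ D₂ d S hS hv hov c' hc']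
  refine mul_neg_of_neg_of_pos (mul_neg_of_pos_of_neg ?_ (sub_neg.2 hlt))
    (mul_pos (starWeight_pos w hw S v) (real_avoid_pos w hw hd))
  exact obsConst_pos w hw (fun h => ho (Finset.mem_coe.1 h)) (fun h => hv (Finset.mem_coe.1 h)) hov

/-! ### Packaging: the strengthened hierarchies fail -/

/-- **No larger observer constant is admissible at `Y = ∅`**: for non-degenerate weights and every `p' > p` there is an
increasing functional (namely `f_S`) whose margin with `p'` in place of `p` is negative.
(paper-2 track (ii), Prop. `prop:csh-sharp` (c)) -/
theorem exists_cshMarg_neg_of_obsConst_lt [Fintype V] (w : Sym2 V → unitInterval) (hw : ∀ e, 0 < w e ∧ w e < 1)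
    (x v o : V) (D : List V) (S : Finset V) (hS : (↑S : Set V) = {x} ∪ {d | d ∈ D}) (hv : v ∉ S) {p' : ℝ}
    (hp' : obsConst w o v ↑S < p') :
    ∃ f : Set (Sym2 V) → ℝ, Monotone f ∧ cshMarg (decoyList w {x} D) p' o v (covD w x ∅ f) < 0 :=
  ⟨allOpenTo S v, allOpenTo_monotone S v, cshMarg_allOpenTo_neg_of_obsConst_lt w hw x v o D S hS hv hp'⟩

/-- **No larger decoy constant at `o` is admissible at `Y = ∅`** (one decoy, its constant changed at `o` only).
(paper-2 track (ii), Prop. `prop:csh-sharp` (c)) -/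
theorem exists_cshMarg_neg_of_lt_at_o [Fintype V] (w : Sym2 V → unitInterval) (hw : ∀ e, 0 < w e ∧ w e < 1)
    (x v o : V) (D₁ D₂ : List V) (d : V) (S : Finset V) (hS : (↑S : Set V) = {x} ∪ {d' | d' ∈ D₁ ++ d :: D₂})
    (hv : v ∉ S) (hov : o ≠ v) (ho₂ : o ∉ D₂) (hd : d ∉ ({x} ∪ {d' | d' ∈ D₁} : Set V)) (c' : V → ℝ)
    (hc' : ∀ u, u ≠ o → c' u = avoidConst w d ({x} ∪ {d' | d' ∈ D₁}) u)
    (hlt : avoidConst w d ({x} ∪ {d' | d' ∈ D₁}) o < c' o) :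
    ∃ f : Set (Sym2 V) → ℝ, Monotone f ∧
      cshMarg (decoyList w {x} D₁ ++ (d, c') :: decoyList w (insert d ({x} ∪ {d' | d' ∈ D₁})) D₂)
        (obsConst w o v ↑S) o v (covD w x ∅ f) < 0 :=
  ⟨allOpenTo S v, allOpenTo_monotone S v,
    cshMarg_allOpenTo_neg_of_lt_at_o w hw x v o D₁ D₂ d S hS hv hov ho₂ hd c' hc' hlt⟩

/-- **No smaller decoy constant at `v` is admissible at `Y = ∅`** (one decoy, its constant changed at `v` only; `o ∉ S`).
(paper-2 track (ii), Prop. `prop:csh-sharp` (c)) -/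
theorem exists_cshMarg_neg_of_lt_at_v [Fintype V] (w : Sym2 V → unitInterval) (hw : ∀ e, 0 < w e ∧ w e < 1)
    (x v o : V) (D₁ D₂ : List V) (d : V) (S : Finset V) (hS : (↑S : Set V) = {x} ∪ {d' | d' ∈ D₁ ++ d :: D₂})
    (hv : v ∉ S) (ho : o ∉ S) (hov : o ≠ v) (hd : d ∉ ({x} ∪ {d' | d' ∈ D₁} : Set V)) (c' : V → ℝ)
    (hc' : ∀ u, u ≠ v → c' u = avoidConst w d ({x} ∪ {d' | d' ∈ D₁}) u)
    (hlt : c' v < avoidConst w d ({x} ∪ {d' | d' ∈ D₁}) v) :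
    ∃ f : Set (Sym2 V) → ℝ, Monotone f ∧
      cshMarg (decoyList w {x} D₁ ++ (d, c') :: decoyList w (insert d ({x} ∪ {d' | d' ∈ D₁})) D₂)
        (obsConst w o v ↑S) o v (covD w x ∅ f) < 0 :=
  ⟨allOpenTo S v, allOpenTo_monotone S v,
    cshMarg_allOpenTo_neg_of_lt_at_v w hw x v o D₁ D₂ d S hS hv ho hov hd c' hc' hlt⟩

end SharpWitness

end CSH

end Summit.CriticalPhenomena.PercolationContinuityZ3.Theorems
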